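import Literature.MathematicalPhysics.QuantumFieldTheory.Balaban1983to89.B7Prop2Explicit

/-!
# Bałaban's renormalization group for 4-d lattice Yang–Mills — B7 (11) «\overline{U^u} = (Ū)^u», the gauge
covariance of the averaging operation, PROVED for the `k`-fold block average (43) on `ℤ^d` under the hypotheses
of Proposition 2, together with (45) «|V₀(∂p) − 1| = |V(∂p) − 1|» (`B7AvgGaugeCovariance`)

Source under audit (PAPER SUB-CELL B07): T. Bałaban, *Averaging operations for lattice gauge theories*,
Commun. Math. Phys. **98** (1985) 17–51 [cite: Balaban1985Averaging] ("B7").  Pages quoted below were READ AS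
IMAGES from the cell's renders (`1985-cmp98-averaging-p003/p008`, journal pp. 19, 24).

## What the paper prints

* p. 19, before (11): «A first condition is connected with the fact that we consider gauge-invariant quantities,
  so we demand that the averaging preserves gauge transformations, i.e.,
  (11) `(\overline{U^u})(y, y′) = u(y)Ū(y, y′)u⁻¹(y′)`, or `\overline{U^u} = (Ū)^u`.
  This property implies that the renormalization transformation (10) transforms gauge-invariant functions `ρ`
  into gauge-invariant `ρ′`.»
* p. 24, after (43): «Let us notice also that the property (11) is satisfied. Indeed, for an arbitrary gauge
  field configuration `U` and a gauge transformation `u`, we have `U^u(Γ_{c,x})U^u(c)⁻¹ =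
  u(c₋)U(Γ_{c,x})U(c)⁻¹u⁻¹(c₋)`; thus the matrices `U^u(Γ_{c,x})U^u(c)⁻¹` and `U(Γ_{c,x})U(c)⁻¹` are unitarily
  equivalent, their eigenvalues are equal, and by the definition (22) their logarithms are unitarily equivalent
  with the same unitary operator `u(c₋)`. Then from (42) we get `(\overline{U^u})_c = u(c₋)Ū_c u⁻¹(c₊)`.»
* p. 24, (45): «`|V₀(∂p) − 1| = |V(∂p) − 1| < α₀`, `|V̄(∂p′) − 1| = |V̄₀(∂p′) − 1|`» (`V₀ = V^{v₀}`).

## What is kernel-checked here (all statements over the concrete objects of `B7Prop1Explicit` / `B7Prop2Explicit`)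

* `norm_hol_gaugeAct_plaqWord`, `pdev_gaugeAct` — (45): a gauge transformation with values in
  `{|u| ≤ 1, |u⁻¹| ≤ 1}` (`U1`, containing `U(N)` and every `G` of `AvgClosed`) does not change any `|V(∂p) − 1|`,
  hence not `sup_p |V(∂p) − 1|` (`pdev`): the hypothesis (44)/(52) is gauge invariant.
* `avgIter_gaugeAct` — **(11) for the `k`-fold average (43)**: under the hypotheses of Prop. 2 as proved in
  `B7Prop2Explicit.prop2_explicit` (`G` closed under the average, `C₀α₀ ≤ ⅓`, `2α₀ ≤ c₂′`, (52)
  `sup_p |U(∂p) − 1| < α₀L^{−2k}`), for every `j ≤ k`,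
  `\overline{(U^u)}^j = (Ū^j)^{u_j}`, `u_j(z) = u(L^j z)` — the gauge transformation restricted to the sites of
  `Ω^{(j)} = L^jℤ^d` (identified with `ℤ^d` by the DICTIONARY of `B7Prop2Explicit`: `avgIter L V (j+1) =
  rescale L (bavg L (avgIter L V j))`).  The one-step case `(\overline{U^u})_c = u(c₋)Ū_c u⁻¹(c₊)` is
  `B7Prop1Explicit.bavg_gaugeAct` (gen 13), valid whenever all `U(Γ_{c,x})U(c)⁻¹` lie inside the unit ball around
  `1` (the domain of the series (21), the tree's logarithm; print's is (22)–(23)); the induction over `j` needs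
  exactly that for every intermediate `Ū^j`, which is what (53) provides (`Wcx_avgIter_lt_one`: all
  `Ū^j(Γ_{c,x})Ū^j(c)⁻¹` lie within `1/32` of `1`, via `B7Prop2Explicit.norm_Wcx_sub_one_le` and
  `prop2_explicit_lt_two` at level `j`).
* `hol_plaqWord_avgIter_gaugeAct`, `pdev_avgIter_gaugeAct` — the second half of (45) for `Ū^j`:
  `\overline{(U^u)}^j(∂p′) = u(L^j z) Ū^j(∂p′) u(L^j z)⁻¹` and `sup |\overline{(U^u)}^j(∂p′) − 1| = sup |Ū^j(∂p′) − 1|`.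
* `prop2_hyp_gaugeAct` — bookkeeping: the hypothesis (52) for `U^u` is the hypothesis (52) for `U`.

## ABSOLUTE-RULE LEDGER
Hypotheses of every theorem: NONE beyond the displayed ones (all discharged objects are the concrete `gaugeAct`
(8), `bavg` (42), `avgIter` (43), `pdev` of the tree).  No `B7.Prop*` placeholder is assumed; nothing of the
manuscript is cited as a fact.  Axioms: the three standard ones.

## DIVERGENCES from print (located)
(a) Print states (11) as a DEMAND on a general averaging operation (p. 19) and verifies it for (42) in one sentence
    (p. 24); the `k`-fold statement is not displayed separately — it is the composition of one-step instances, and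
    that composition is what is proved here, each step requiring the tree's logarithm to be taken inside its
    domain, which print guarantees through Prop. 2/(53) exactly as here (print's logarithm (22)–(23) is defined on
    all unitary matrices, conjugation-equivariantly — (23) takes the eigenvalue arguments in `]−π, π]`, no cut — so
    the p. 24 sentence covers arbitrary `U`; the tree's logarithm is the series (21), `|X − 1| < 1` (D-b07g13.1),
    whence (11) for (43) is certified here only inside the Prop. 2 regime).
(b) Print's `u` is `G`-valued (`G ⊂ U(N)`); here `u` is only required to take values in `{|u| ≤ 1, |u⁻¹| ≤ 1}`.
(c) The consequence (12)–(13) (gauge invariance of the renormalized DENSITIES `ρ′`) is measure-theoretic and is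
    NOT treated (no Haar measure here).
(d) Levels are identified with `ℤ^d` (infinite lattice, no torus `Ω`), as in `B7Prop1Explicit`/`B7Prop2Explicit`.
(e) (45) is certified for every `u` with values in `U1` (print: the axial gauge transformation `v₀` of p. 24)
    and for the supremum `pdev`; its second half `|V̄(∂p′) − 1| = |V̄₀(∂p′) − 1|` for every `Ū^j`, `j ≤ k`
    (print: the one-step `V̄`).

v1.0.1 (gen 16): module docstring only — DIVERGENCES (a) rewritten and (e) added after the cross-lineage read
C-pv26g9-2 (F1/F2); every declaration byte-identical to v1 (p185535).

NOT summit progress: bookkeeping identity of the averaging operation; ultraviolet stability needs Prop. 3 and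
papers B8–B13.
-/

noncomputable section

open scoped BigOperators
open NormedSpace Finset

namespace Literature.MathematicalPhysics.QuantumFieldTheory.Balaban1983to89.B7AvgGaugeCovariance

open B7Prop1Explicit B7Prop2Explicit

-- `Site` alone would resolve to the torus sites of `Setup.lean`; re-export the `ℤ^d` sites of `B7Prop1Explicit`.
export B7Prop1Explicit (Site)

variable {d : ℕ}

/-! ## §1 The gauge transformation restricted to the sites of `Ω^{(j)} = L^jℤ^d` -/

section Levels

variable {G : Type*}

/-- `u_j(z) = u(L^j z)`: the gauge function `u` of the unit lattice read at the sites of the `j`-th block lattice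
`Ω^{(j)} = L^jℤ^d ≅ ℤ^d` (DICTIONARY of `B7Prop2Explicit.rescale`). [cite: Balaban1985Averaging, (1) p.17, (11) p.19] -/
def uLev (L : ℕ) (u : Site d → G) (j : ℕ) : Site d → G := fun z => u (((L : ℤ) ^ j) • z)

/-- `uLev_apply`: unfolding. [folklore] -/
@[simp] theorem uLev_apply (L : ℕ) (u : Site d → G) (j : ℕ) (z : Site d) :
    uLev L u j z = u (((L : ℤ) ^ j) • z) := rfl

/-- `uLev_zero`: `u_0 = u`. [folklore] -/
@[simp] theorem uLev_zero (L : ℕ) (u : Site d → G) : uLev L u 0 = u := by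
  funext z; simp [uLev]

/-- `uLev_smul`: `u_j(Lz) = u_{j+1}(z)`. [folklore] -/
theorem uLev_smul (L : ℕ) (u : Site d → G) (j : ℕ) (z : Site d) :
    uLev L u j ((L : ℤ) • z) = uLev L u (j + 1) z := by
  simp only [uLev_apply, smul_smul, pow_succ]

/-- `uLev_smul_add`: `u_j(Lz + Le_κ) = u_{j+1}(z + e_κ)`. [folklore] -/
theorem uLev_smul_add (L : ℕ) (u : Site d → G) (j : ℕ) (z : Site d) (κ : Fin d) :
    uLev L u j ((L : ℤ) • z + (L : ℤ) • e κ) = uLev L u (j + 1) (z + e κ) := by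
  rw [← smul_add, uLev_smul]

end Levels

/-! ## §2 (45): gauge invariance of the plaquette deviations -/

section Dev

variable {𝔸 : Type*} [NormedRing 𝔸] [NormOneClass 𝔸]

/-- Conjugation by `u ∈ {|u| ≤ 1, |u⁻¹| ≤ 1}` preserves `|X − 1|` ("the matrices … are unitarily equivalent",
p. 24). [cite: Balaban1985Averaging, p.24] -/
theorem norm_conj_sub_one_eq {u X : 𝔸ˣ} (hu : u ∈ U1 𝔸) :
    ‖((u * X * u⁻¹ : 𝔸ˣ) : 𝔸) - 1‖ = ‖(X : 𝔸) - 1‖ := by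
  refine le_antisymm ?_ (norm_sub_one_le_of_conj hu)
  have h := norm_sub_one_le_of_conj (X := u * X * u⁻¹) ((U1 𝔸).inv_mem hu)
  have he : u⁻¹ * (u * X * u⁻¹) * u⁻¹⁻¹ = X := by group
  rwa [he] at h

/-- **(45), first half** «`|V₀(∂p) − 1| = |V(∂p) − 1|`»: a gauge transformation (8) with values in
`{|u| ≤ 1, |u⁻¹| ≤ 1}` does not change the plaquette deviations. [cite: Balaban1985Averaging, (45) p.24] -/
theorem norm_hol_gaugeAct_plaqWord {u : Site d → 𝔸ˣ} (hu : ∀ x, u x ∈ U1 𝔸) (V : Site d → Fin d → 𝔸ˣ)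
    (x : Site d) (κ ν : Fin d) :
    ‖((hol (gaugeAct u V) x (plaqWord κ ν) : 𝔸ˣ) : 𝔸) - 1‖ = ‖((hol V x (plaqWord κ ν) : 𝔸ˣ) : 𝔸) - 1‖ := by
  rw [hol_gaugeAct_closed _ _ _ _ (disp_plaqWord κ ν)]
  exact norm_conj_sub_one_eq (hu x)

/-- **(45)** for the supremum: `sup_p |V^u(∂p) − 1| = sup_p |V(∂p) − 1|` — the hypotheses (44) and (52) are gauge
invariant. [cite: Balaban1985Averaging, (45) p.24] -/
theorem pdev_gaugeAct {u : Site d → 𝔸ˣ} (hu : ∀ x, u x ∈ U1 𝔸) (V : Site d → Fin d → 𝔸ˣ) :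
    pdev (gaugeAct u V) = pdev V := by
  unfold pdev
  exact iSup_congr fun p => norm_hol_gaugeAct_plaqWord hu V p.1 p.2.1 p.2.2

/-- A gauge transformation with values in `{|u| ≤ 1, |u⁻¹| ≤ 1}`, read on any block lattice, has values there.
[folklore] -/
theorem uLev_mem {u : Site d → 𝔸ˣ} (hu : ∀ x, u x ∈ U1 𝔸) (L j : ℕ) (z : Site d) : uLev L u j z ∈ U1 𝔸 :=
  hu _

end Dev

/-! ## §3 (11) for the `k`-fold average (43) under the hypotheses of Proposition 2 -/

section Main

variable {𝔸 : Type*} [NormedRing 𝔸] [NormOneClass 𝔸] [NormedAlgebra ℂ 𝔸] [CompleteSpace 𝔸]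

omit [NormOneClass 𝔸] [NormedAlgebra ℂ 𝔸] [CompleteSpace 𝔸] in
/-- Monotonicity of the hypothesis (52) in `k`: `α₀L^{−2k} ≤ α₀L^{−2j}` for `j ≤ k`. [folklore] -/
theorem hyp52_mono {L : ℕ} (hL : 1 ≤ L) {α₀ : ℝ} (hα : 0 ≤ α₀) {j k : ℕ} (hj : j ≤ k)
    {V : Site d → Fin d → 𝔸ˣ} (h52 : pdev V < α₀ * (((L : ℝ) ^ k)⁻¹) ^ 2) :
    pdev V < α₀ * (((L : ℝ) ^ j)⁻¹) ^ 2 := by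
  have hL1r : (1 : ℝ) ≤ L := by exact_mod_cast hL
  refine h52.trans_le (mul_le_mul_of_nonneg_left (pow_le_pow_left₀ (by positivity) ?_ 2) hα)
  exact inv_anti₀ (by positivity) (pow_le_pow_right₀ hL1r hj)

/-- (53)/(54) at every intermediate level: under the hypotheses of Prop. 2 for `k` steps, every `Ū^j`, `j ≤ k`,
satisfies `sup |Ū^j(∂p) − 1| < 2α₀` (Prop. 2 applied with `k := j`). [cite: Balaban1985Averaging, (53)–(54) p.26] -/
theorem pdev_avgIter_lt_two_alpha (L : ℕ) (hL : 2 ≤ L) {G : Subgroup 𝔸ˣ} (hG : AvgClosed d L G) (k : ℕ)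
    (V : Site d → Fin d → 𝔸ˣ) (hV : ∀ x κ, V x κ ∈ G) {α₀ : ℝ} (hα : 0 < α₀)
    (hα3 : C0 d * α₀ ≤ 1 / 3) (hα2 : 2 * α₀ ≤ c2' d L)
    (h52 : pdev V < α₀ * (((L : ℝ) ^ k)⁻¹) ^ 2) :
    ∀ j ≤ k, pdev (avgIter L V j) < 2 * α₀ := fun j hj =>
  prop2_explicit_lt_two L hL hG j V hV hα hα3 hα2 (hyp52_mono (le_trans (by norm_num) hL) hα.le hj h52)

/-- The domain condition of the logarithm (22) at every intermediate level: under the hypotheses of Prop. 2, for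
every `j ≤ k`, every bond `c` of the `L`-lattice over `Ω^{(j)}` and every `x ∈ B(c₋)`,
`|Ū^j(Γ_{c,x})Ū^j(c)⁻¹ − 1| < 1` (indeed `≤ 1/32`: p. 25 "`|V₀(Γ_{c,x}) − 1| < … = O(1)L²α₀`" at level `j` with
`2α₀ ≤ c₂′`). [cite: Balaban1985Averaging, p.25, (53) p.26] -/
theorem Wcx_avgIter_lt_one (L : ℕ) (hL : 2 ≤ L) {G : Subgroup 𝔸ˣ} (hG : AvgClosed d L G) (k : ℕ)
    (V : Site d → Fin d → 𝔸ˣ) (hV : ∀ x κ, V x κ ∈ G) {α₀ : ℝ} (hα : 0 < α₀)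
    (hα3 : C0 d * α₀ ≤ 1 / 3) (hα2 : 2 * α₀ ≤ c2' d L)
    (h52 : pdev V < α₀ * (((L : ℝ) ^ k)⁻¹) ^ 2) :
    ∀ j ≤ k, ∀ (q : Site d) (κ : Fin d) (r : Fin d → Fin L),
      ‖((Wcx L (avgIter L V j) q κ (boxVec L r) : 𝔸ˣ) : 𝔸) - 1‖ < 1 := by
  intro j hj q κ r
  have hL1 : 1 ≤ L := le_trans (by norm_num) hL
  have hL1r : (1 : ℝ) ≤ L := by exact_mod_cast hL1
  have hU : ∀ x κ, avgIter L V j x κ ∈ U1 𝔸 := fun x κ =>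
    hG.le_U1 (avgIter_mem L hL hG k V hV hα hα3 hα2 h52 j hj x κ)
  set a : ℝ := pdev (avgIter L V j) with ha
  have ha0 : 0 ≤ a := pdev_nonneg _
  have ha2 : a < 2 * α₀ := pdev_avgIter_lt_two_alpha L hL hG k V hV hα hα3 hα2 h52 j hj
  have hpos : (0 : ℝ) < 512 * ((d : ℝ) + 1) * (d + 4) * (L : ℝ) ^ 2 := by positivity
  have hac : a ≤ 1 / (512 * ((d : ℝ) + 1) * (d + 4) * (L : ℝ) ^ 2) := by
    have : a ≤ c2' d L := by linarith
    exact this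
  have hsmall : 512 * (d + 1) * (d + 4) * (L : ℝ) ^ 2 * a ≤ 1 := by
    rw [le_div_iff₀ hpos] at hac; linarith
  have h44 : ∀ (x : Site d) (κ κ' : Fin d), κ ≠ κ' →
      ‖((hol (avgIter L V j) x (plaqWord κ κ') : 𝔸ˣ) : 𝔸) - 1‖ ≤ a := fun x κ κ' _ => le_pdev hU x κ κ'
  calc ‖((Wcx L (avgIter L V j) q κ (boxVec L r) : 𝔸ˣ) : 𝔸) - 1‖
      ≤ 2 * (8 * (d + 1) * (d + 4) * (L : ℝ) ^ 2 * a) := norm_Wcx_sub_one_le L hL1 _ hU ha0 hsmall h44 q κ r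
    _ = (512 * (d + 1) * (d + 4) * (L : ℝ) ^ 2 * a) / 32 := by ring
    _ ≤ 1 / 32 := by gcongr
    _ < 1 := by norm_num

/-- **(11) «`\overline{U^u} = (Ū)^u`» for the `k`-fold average (43)** ("Let us notice also that the property (11)
is satisfied", p. 24): under the hypotheses of Proposition 2 (`B7Prop2Explicit.prop2_explicit`), for every gauge
transformation `u` with values in `{|u| ≤ 1, |u⁻¹| ≤ 1}` and every `j ≤ k`,
`\overline{(U^u)}^j = (Ū^j)^{u_j}` with `u_j(z) = u(L^j z)`.  Proof = the printed one iterated: the one-step identity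
`(\overline{U^u})_c = u(c₋)Ū_c u⁻¹(c₊)` (`B7Prop1Explicit.bavg_gaugeAct`, from "their logarithms are unitarily
equivalent with the same unitary operator `u(c₋)`"), applicable at level `j` because every
`Ū^j(Γ_{c,x})Ū^j(c)⁻¹` lies in the domain of (21)–(22) (`Wcx_avgIter_lt_one`); the hypothesis (52) for `U^u`
is the one for `U` (`pdev_gaugeAct`). [cite: Balaban1985Averaging, (11) p.19, p.24, (43) p.24] -/
theorem avgIter_gaugeAct (L : ℕ) (hL : 2 ≤ L) {G : Subgroup 𝔸ˣ} (hG : AvgClosed d L G) (k : ℕ)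
    (V : Site d → Fin d → 𝔸ˣ) (hV : ∀ x κ, V x κ ∈ G) {u : Site d → 𝔸ˣ} (hu : ∀ x, u x ∈ U1 𝔸)
    {α₀ : ℝ} (hα : 0 < α₀) (hα3 : C0 d * α₀ ≤ 1 / 3) (hα2 : 2 * α₀ ≤ c2' d L)
    (h52 : pdev V < α₀ * (((L : ℝ) ^ k)⁻¹) ^ 2) :
    ∀ j ≤ k, avgIter L (gaugeAct u V) j = gaugeAct (uLev L u j) (avgIter L V j) := by
  have hW := Wcx_avgIter_lt_one L hL hG k V hV hα hα3 hα2 h52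
  intro j
  induction j with
  | zero => intro _; simp
  | succ j ih =>
      intro hjk
      have hj : j ≤ k := Nat.le_of_succ_le hjk
      funext z κ
      rw [avgIter_succ, avgIter_succ, rescale_apply, ih hj,
        bavg_gaugeAct L (fun x => uLev_mem hu L j x) _ _ _ (hW j hj _ κ)]
      simp only [gaugeAct, rescale_apply, uLev_smul, uLev_smul_add]

/-- (11) at the top level `j = k`. [cite: Balaban1985Averaging, (11) p.19, (43) p.24] -/
theorem avgIter_gaugeAct_top (L : ℕ) (hL : 2 ≤ L) {G : Subgroup 𝔸ˣ} (hG : AvgClosed d L G) (k : ℕ)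
    (V : Site d → Fin d → 𝔸ˣ) (hV : ∀ x κ, V x κ ∈ G) {u : Site d → 𝔸ˣ} (hu : ∀ x, u x ∈ U1 𝔸)
    {α₀ : ℝ} (hα : 0 < α₀) (hα3 : C0 d * α₀ ≤ 1 / 3) (hα2 : 2 * α₀ ≤ c2' d L)
    (h52 : pdev V < α₀ * (((L : ℝ) ^ k)⁻¹) ^ 2) :
    avgIter L (gaugeAct u V) k = gaugeAct (uLev L u k) (avgIter L V k) :=
  avgIter_gaugeAct L hL hG k V hV hu hα hα3 hα2 h52 k le_rfl

/-- **(45), second half, for `Ū^j`** «`|V̄(∂p′) − 1| = |V̄₀(∂p′) − 1|`»: the plaquette variables of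
`\overline{(U^u)}^j` are the conjugates `u(L^j z) Ū^j(∂p′) u(L^j z)⁻¹`. [cite: Balaban1985Averaging, (45) p.24] -/
theorem hol_plaqWord_avgIter_gaugeAct (L : ℕ) (hL : 2 ≤ L) {G : Subgroup 𝔸ˣ} (hG : AvgClosed d L G) (k : ℕ)
    (V : Site d → Fin d → 𝔸ˣ) (hV : ∀ x κ, V x κ ∈ G) {u : Site d → 𝔸ˣ} (hu : ∀ x, u x ∈ U1 𝔸)
    {α₀ : ℝ} (hα : 0 < α₀) (hα3 : C0 d * α₀ ≤ 1 / 3) (hα2 : 2 * α₀ ≤ c2' d L)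
    (h52 : pdev V < α₀ * (((L : ℝ) ^ k)⁻¹) ^ 2) (j : ℕ) (hj : j ≤ k) (z : Site d) (μ ν : Fin d) :
    hol (avgIter L (gaugeAct u V) j) z (plaqWord μ ν)
      = u (((L : ℤ) ^ j) • z) * hol (avgIter L V j) z (plaqWord μ ν) * (u (((L : ℤ) ^ j) • z))⁻¹ := by
  rw [avgIter_gaugeAct L hL hG k V hV hu hα hα3 hα2 h52 j hj, hol_gaugeAct_closed _ _ _ _ (disp_plaqWord μ ν),
    uLev_apply]

/-- **(45), second half, for `Ū^j`**: `sup_{p′} |\overline{(U^u)}^j(∂p′) − 1| = sup_{p′} |Ū^j(∂p′) − 1|` — the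
conclusion (54) of Prop. 2 is gauge invariant. [cite: Balaban1985Averaging, (45) p.24, (54) p.26] -/
theorem pdev_avgIter_gaugeAct (L : ℕ) (hL : 2 ≤ L) {G : Subgroup 𝔸ˣ} (hG : AvgClosed d L G) (k : ℕ)
    (V : Site d → Fin d → 𝔸ˣ) (hV : ∀ x κ, V x κ ∈ G) {u : Site d → 𝔸ˣ} (hu : ∀ x, u x ∈ U1 𝔸)
    {α₀ : ℝ} (hα : 0 < α₀) (hα3 : C0 d * α₀ ≤ 1 / 3) (hα2 : 2 * α₀ ≤ c2' d L)
    (h52 : pdev V < α₀ * (((L : ℝ) ^ k)⁻¹) ^ 2) (j : ℕ) (hj : j ≤ k) :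
    pdev (avgIter L (gaugeAct u V) j) = pdev (avgIter L V j) := by
  rw [avgIter_gaugeAct L hL hG k V hV hu hα hα3 hα2 h52 j hj]
  exact pdev_gaugeAct (fun x => uLev_mem hu L j x) _

omit [NormedAlgebra ℂ 𝔸] [CompleteSpace 𝔸] in
/-- Bookkeeping: the hypothesis (52) of Prop. 2 for `U^u` is the hypothesis (52) for `U`.
[cite: Balaban1985Averaging, (45) p.24, (52) p.26] -/
theorem prop2_hyp_gaugeAct {u : Site d → 𝔸ˣ} (hu : ∀ x, u x ∈ U1 𝔸) (V : Site d → Fin d → 𝔸ˣ) (L k : ℕ)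
    (α₀ : ℝ) : pdev (gaugeAct u V) < α₀ * (((L : ℝ) ^ k)⁻¹) ^ 2 ↔ pdev V < α₀ * (((L : ℝ) ^ k)⁻¹) ^ 2 := by
  rw [pdev_gaugeAct hu]

/-- (11) with a `G`-valued gauge transformation, `G` the closed gauge group of Prop. 2 (print: `u` is `G`-valued,
`G ⊂ U(N)`): `\overline{(U^u)}^j = (Ū^j)^{u_j}` for all `j ≤ k`, and `U^u`, all `\overline{(U^u)}^j` are `G`-valued.
[cite: Balaban1985Averaging, (11) p.19, p.24] -/
theorem avgIter_gaugeAct_of_mem (L : ℕ) (hL : 2 ≤ L) {G : Subgroup 𝔸ˣ} (hG : AvgClosed d L G) (k : ℕ)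
    (V : Site d → Fin d → 𝔸ˣ) (hV : ∀ x κ, V x κ ∈ G) {u : Site d → 𝔸ˣ} (hu : ∀ x, u x ∈ G)
    {α₀ : ℝ} (hα : 0 < α₀) (hα3 : C0 d * α₀ ≤ 1 / 3) (hα2 : 2 * α₀ ≤ c2' d L)
    (h52 : pdev V < α₀ * (((L : ℝ) ^ k)⁻¹) ^ 2) :
    ∀ j ≤ k, avgIter L (gaugeAct u V) j = gaugeAct (uLev L u j) (avgIter L V j)
      ∧ ∀ z κ, avgIter L (gaugeAct u V) j z κ ∈ G := by
  intro j hj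
  have h := avgIter_gaugeAct L hL hG k V hV (fun x => hG.le_U1 (hu x)) hα hα3 hα2 h52 j hj
  refine ⟨h, fun z κ => ?_⟩
  rw [h]
  exact G.mul_mem (G.mul_mem (hu _) (avgIter_mem L hL hG k V hV hα hα3 hα2 h52 j hj z κ)) (G.inv_mem (hu _))

end Main

end Literature.MathematicalPhysics.QuantumFieldTheory.Balaban1983to89.B7AvgGaugeCovariance

end
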